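import Summits.ResolutionOfSingularities.ResolutionOfSingularities.Theorems.ConeJumpFrame
import Summits.ResolutionOfSingularities.ResolutionOfSingularities.Theorems.MaxContactCutTowerCut

/-!
# MaxContactCutConeJump («JumpCut», slice 4/4) — the normal-cone jump exit `NormalConeJumpExit`, proved on its landed letter

`decomp-res-lens-2`, generation 30 (RESIDUAL MODE node; lens «structural dichotomy, special vs generic»;
critic row 225 window, pre-ruling 225a).  Host route `MaxContactCut`, item `MaxContactCut.RungOne`
(`stmt-ResolutionOfSingularities-29273`), wired BY NAME through the landed
`CuspX.closes : CuspGenericRung → CuspSpecialRung → RungOne` and the landed 17-binder discharge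
`TowerCut.cuspGenericRung_of_engines` (among its binders `(hN : NormalConeJumpExit)`).
Lean namespace `…Theorems.ConeJump` (the name `…Theorems.JumpCut` is already used in the tree by the unrelated
boundary-ledger files `JumpCutModel` / `JumpCutClasses` / `JumpCutPlateaux`).

## Main results

* `normalConeJumpExit_holds : NormalConeJumpExit` — ENGINE (B) of `CurveLeafExitClasses` (:376), VERBATIM and
  hypothesis-free: on a regular scheme `Y`, for an ideal sheaf `I`, `2 ≤ n` and a uniformly flat curve `η`
  (`IsUniformFlatCurve I n η`: a curve point all of whose closed specialisations carry a flat frame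
  `IsFlatOneAt I n η y` — `c = (c₀, c₁)` generating the curve prime, inert `v`, `spanFinrank 𝔪_y = 3`, a unit
  `λ`, `g ∈ (c)ⁿ⁺¹`, `c₀ⁿ + λ v c₁ⁿ + g ∈ I_y ⊆ (c)ⁿ`), the package `⟨I, [], n⟩` exits over `{y | η ⤳ y}`
  (`RelativeDeltaCut.PackageExitsOver`).
* `cuspGenericRung_of_engines` — the landed `TowerCut.cuspGenericRung_of_engines` with `hN` discharged
  (16 engine binders left); `closes_of_engines` displays `MaxContactCut.RungOne` from the 16 engines and
  `CuspX.CuspSpecialRung` via `CuspX.closes` (by name, nothing re-landed).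

## The mechanism (one blow-up; the generic point is handled AT the generic point)

The exit package is the single blow-up of the reduced curve `C₀ = V(𝓘_{closure {η}})`.  `C₀` is regular
(`isRegular_flatCurve_subscheme`: at a closed point `𝒪_y/(c)` with `c` part of a regular system of parameters,
at `η` the residue field) and lies in `supp (I, n)` (`flat_stalkIdeal_le`; at `η` by localisation along
`stalkSpecializes`), so `[C₀]` is weakly admissible with centres over the curve, and `Bl_{C₀} Y` is regular.
KEY INVARIANT (`flatInv_closed`, `flatInv_eta`): at EVERY point `x'` of the blow-up over the curve the controlled
transform `J' = (I𝒪 : 𝓘_Eⁿ)` is `(1)` or `J' ⊄ 𝔪_{x'}²`; hence `ord_{x'} J' ≤ 1 < 2 ≤ n`, the order-`n` locus over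
the curve is EMPTY and the exit clause `ord = n → 2 ≤ τ` holds vacuously (`normalConeJumpExit_holds`).
* Over a CLOSED point `y` (§5): in the `c₀`-chart `J' = (1)` (`flat_zChart`: `F' = 1 + t·(…)`); in the `c₁`-chart
  `F' = e₀ⁿ + (σλ + t r_g)·σv` is a linear form in the regular parameters `(e₀, t, σv)` of the chart stalk
  (`TowerCut.isRsopPart_triple_uChart`) with a UNIT coefficient, so `F' ∉ 𝔪²` (`flat_uChart`,
  `sum_mul_not_mem_sq_of_isRsopPart`).
* Over `η` (§6–§7, no properness / semicontinuity / generisation of the invariant): `𝒪_η = (𝒪_{y₀})_𝔓` for any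
  closed point `y₀` of the curve; there the frame `c` stays quasi-regular and generates `𝔪_η` (`etaFrame`,
  `IsRsopPart.map_of_le_prime`), `μ = λ v` becomes a UNIT, and over the residue field
  `κ(η) = Frac(𝒪_{y₀}/𝔓)` — the fraction field of a Noetherian local DOMAIN whose maximal ideal is principal,
  generated by `v̄` — the fibre polynomial `Xⁿ + μ̄ = Xⁿ + λ̄·v̄` is EISENSTEIN, hence irreducible
  (`irreducible_X_pow_add_C_of_uniformizer`, Gauss's lemma), and so is its reflection `μ̄ Xⁿ + 1`
  (`irreducible_C_mul_X_pow_add_one`).  At a point `x'` over `η` in the `cᵢ`-chart, `F' = G(e) + t·r` with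
  `Ḡ ∈ κ(η)[X]` irreducible; the chart stalk modulo `t` is a localisation of the PID `κ(η)[e]`
  (`chartQuotEquiv`), where an irreducible element is a unit or a uniformizer to first order
  (`isUnit_or_not_mem_sq_of_irreducible`), which lifts to `J' = (1) ∨ J' ⊄ 𝔪²` (`jump_of_irreducible`,
  `jumpChart`).

Sections (this slice): §8 the invariant after the curve blow-up and the engine · §9 corollaries
(§1–§4 = `Theorems/ConeJumpAlg`, §5–§6 = `Theorems/ConeJumpChart`, §7 = `Theorems/ConeJumpFrame`).  All statements are over the tree's landed definitions (`CurveLeafExit.NormalConeJumpExit`,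
`IsUniformFlatCurve`, `IsFlatOneAt`, `RelativeDeltaCut.PackageExitsOver`, `curvePrime`, `CentreSeq`,
`controlledTransform`, `tauAt`); no `Prop`-valued definition, notation or instance is introduced.

Sources: [Hironaka1964] Ch. III §§1–3 (normal flatness, the effect of a permissible blow-up);
[CossartJannsenSaito2020] Ch. 2, Ch. 8; [CossartPiltant2008] Prop. 4.2 (a); [Matsumura1987] Thms. 14.2, 16.2
(regular systems of parameters, quasi-regularity); Eisenstein's criterion and Gauss's lemma (Mathlib).
-/

open IsLocalRing Polynomial
open Literature.AlgebraicGeometry.Resolution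

namespace Summit.ResolutionOfSingularities.ResolutionOfSingularities.Theorems.ConeJump

/-! ## §8  After the curve blow-up: `(1)` or order `≤ 1` at every point over the curve; the engine -/

section SchemeLevel

open CategoryTheory AlgebraicGeometry TopologicalSpace Topology
open Summit.ResolutionOfSingularities.ResolutionOfSingularities.Theorems
open Summit.ResolutionOfSingularities.ResolutionOfSingularities.Theorems.WeakOrderReduction
open Summit.ResolutionOfSingularities.ResolutionOfSingularities.Theorems.RelativeDeltaCut
open Summit.ResolutionOfSingularities.ResolutionOfSingularities.Theorems.CurveLeafExit

variable {Y : Scheme.{0}}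


/-- **Over a flat CLOSED point of the curve** the controlled transform `(𝓘𝒪 : 𝓘_Eⁿ)` of the curve
blow-up is `(1)` or is not inside `𝔪²` (chart dictionary `IsBlowup.exists_reesChart_stalk`, then
`flat_zChart` / `flat_uChart`). [folklore] -/
theorem flatInv_closed [IsLocallyNoetherian Y] (hY : Scheme.IsRegular Y) (C₀ I : Y.IdealSheafData)
    {n : ℕ} (hn : 1 ≤ n) {η : Y} (hC : ∀ (y : Y) (h : η ⤳ y), stalkIdeal C₀ y = curvePrime h)
    (x' : ↑(blowup C₀)) (hfl : IsFlatOneAt I n η (blowup.π C₀ x')) :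
    stalkIdeal (controlledTransform (blowup.π C₀) C₀ I n) x' = ⊤ ∨
      ¬ stalkIdeal (controlledTransform (blowup.π C₀) C₀ I n) x' ≤ maximalIdeal _ ^ 2 := by
  haveI := CentreSeq.isLocallyNoetherian_blowup C₀
  haveI := hY (blowup.π C₀ x')
  obtain ⟨h, c, v, lam, g, hP, hW', hd, hlam, hg, hf, -⟩ := hfl
  have hc : Ideal.span (Set.range c) = stalkIdeal C₀ (blowup.π C₀ x') := by rw [hC _ h, hP]
  obtain ⟨j, 𝔴, χ, hχ, hloc, h𝔴⟩ := (blowup.isBlowup C₀).exists_reesChart_stalk x' c hc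
  have hu : ∀ l, ((blowup.π C₀).stalkMap x').hom (c l) =
      ((blowup.π C₀).stalkMap x').hom (c j) * χ (chartGen c j l) :=
    fun l => by rw [← hχ, ← hχ, ← map_mul, ← reesChartBase_apply_eq_mul_chartGen _ j l]
  have hCmap : (stalkIdeal C₀ (blowup.π C₀ x')).map ((blowup.π C₀).stalkMap x').hom =
      Ideal.span {((blowup.π C₀).stalkMap x').hom (c j)} := by
    rw [← hc, Ideal.map_span_range_eq_span_singleton _ _ j _ hu]
  have hJ' : stalkIdeal (controlledTransform (blowup.π C₀) C₀ I n) x' =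
      Submodule.colon ((stalkIdeal I (blowup.π C₀ x')).map ((blowup.π C₀).stalkMap x').hom)
        ((Ideal.span {((blowup.π C₀).stalkMap x').hom (c j)} ^ n : Ideal _) : Set _) := by
    rw [controlledTransform, stalkIdeal_colon, stalkIdeal_pow, stalkIdeal_comap_eq_map_stalkMap,
      stalkIdeal_comap_eq_map_stalkMap, hCmap]
  rw [hJ']
  have hW : Ideal.span (Set.range (Fin.append c ![v])) = maximalIdeal _ := by
    rw [← hW', range_fin_append, Matrix.range_cons, Matrix.range_empty, Set.union_empty]
  have hd' : (maximalIdeal (Y.presheaf.stalk (blowup.π C₀ x'))).spanFinrank = 2 + 1 := hd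
  obtain rfl | rfl : j = 0 ∨ j = 1 := by fin_cases j <;> simp
  · exact Or.inl (flat_zChart c v lam g hW hg hf 𝔴 χ hloc h𝔴 _ hχ)
  · exact flat_uChart hn c v lam g hW hd' hlam hg hf 𝔴 χ hloc h𝔴 _ hχ

/-- **Over the GENERIC point `η` of the curve** the controlled transform is `(1)` or is not inside `𝔪²`:
the frame at `η` (`etaFrame`) and the generic chart law `jumpChart` with `G = Xⁿ + μ` in the `c₁`-chart,
`G = μ Xⁿ + 1` in the `c₀`-chart.  NO semicontinuity / properness is used: the analysis happens at `η`.
[folklore] -/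
theorem flatInv_eta [IsLocallyNoetherian Y] (hY : Scheme.IsRegular Y) (C₀ I : Y.IdealSheafData)
    {n : ℕ} (hn : 0 < n) {η y₀ : Y} (hy₀η : y₀ ≠ η)
    (hCη : stalkIdeal C₀ η = maximalIdeal (Y.presheaf.stalk η)) (hfl : IsFlatOneAt I n η y₀)
    (x' : ↑(blowup C₀)) (hx' : blowup.π C₀ x' = η) :
    stalkIdeal (controlledTransform (blowup.π C₀) C₀ I n) x' = ⊤ ∨
      ¬ stalkIdeal (controlledTransform (blowup.π C₀) C₀ I n) x' ≤ maximalIdeal _ ^ 2 := by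
  subst hx'
  haveI := CentreSeq.isLocallyNoetherian_blowup C₀
  obtain ⟨c, μ, g, I₀, hq, hcm, hc, hI₀, -, hg, hf, hirr1, hirr0⟩ := etaFrame hY C₀ I hn hy₀η hCη hfl
  obtain ⟨j, 𝔴, χ, hχ, hloc, h𝔴⟩ := (blowup.isBlowup C₀).exists_reesChart_stalk x' c hc
  have hu : ∀ l, ((blowup.π C₀).stalkMap x').hom (c l) =
      ((blowup.π C₀).stalkMap x').hom (c j) * χ (chartGen c j l) :=
    fun l => by rw [← hχ, ← hχ, ← map_mul, ← reesChartBase_apply_eq_mul_chartGen _ j l]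
  have hCmap : (stalkIdeal C₀ (blowup.π C₀ x')).map ((blowup.π C₀).stalkMap x').hom =
      Ideal.span {((blowup.π C₀).stalkMap x').hom (c j)} := by
    rw [← hc, Ideal.map_span_range_eq_span_singleton _ _ j _ hu]
  have hJ' : stalkIdeal (controlledTransform (blowup.π C₀) C₀ I n) x' =
      Submodule.colon ((stalkIdeal I (blowup.π C₀ x')).map ((blowup.π C₀).stalkMap x').hom)
        ((Ideal.span {((blowup.π C₀).stalkMap x').hom (c j)} ^ n : Ideal _) : Set _) := by
    rw [controlledTransform, stalkIdeal_colon, stalkIdeal_pow, stalkIdeal_comap_eq_map_stalkMap,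
      stalkIdeal_comap_eq_map_stalkMap, hCmap]
  rw [hJ']
  have hσg : ((blowup.π C₀).stalkMap x').hom g ∈
      Ideal.span {((blowup.π C₀).stalkMap x').hom (c j) ^ (n + 1)} := by
    have h := Ideal.mem_map_of_mem ((blowup.π C₀).stalkMap x').hom hg
    rwa [Ideal.map_pow, Ideal.map_span_range_eq_span_singleton _ c j _ hu, Ideal.span_singleton_pow] at h
  obtain ⟨r, hr⟩ := Ideal.mem_span_singleton'.mp hσg
  obtain rfl | rfl : j = 0 ∨ j = 1 := by fin_cases j <;> simp
  · -- the `c₀`-chart: `F' = μ e₁ⁿ + 1 + t·r`, reduction `μ̄ Xⁿ + 1`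
    have hf' : ((blowup.π C₀).stalkMap x').hom (c 0 ^ n + μ * c 1 ^ n + g) =
        ((blowup.π C₀).stalkMap x').hom (c 0) ^ n *
          ((Polynomial.C μ * Polynomial.X ^ n + 1).eval₂ ((blowup.π C₀).stalkMap x').hom
              (χ (chartGen c 0 1)) + ((blowup.π C₀).stalkMap x').hom (c 0) * r) := by
      rw [Polynomial.eval₂_add, Polynomial.eval₂_mul, Polynomial.eval₂_C, Polynomial.eval₂_pow,
        Polynomial.eval₂_X, Polynomial.eval₂_one]
      simp only [map_add, map_mul, map_pow, hu 1, ← hr]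
      ring
    exact jumpChart c hq hcm 0 1 (by decide) 𝔴 χ hloc h𝔴 _ hχ (TowerCut.mem_colon_of_map_eq _ hf hf') _ r
      rfl hI₀ hirr0
  · -- the `c₁`-chart: `F' = e₀ⁿ + μ + t·r`, reduction `Xⁿ + μ̄`
    have hf' : ((blowup.π C₀).stalkMap x').hom (c 0 ^ n + μ * c 1 ^ n + g) =
        ((blowup.π C₀).stalkMap x').hom (c 1) ^ n *
          ((Polynomial.X ^ n + Polynomial.C μ).eval₂ ((blowup.π C₀).stalkMap x').hom
              (χ (chartGen c 1 0)) + ((blowup.π C₀).stalkMap x').hom (c 1) * r) := by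
      rw [Polynomial.eval₂_add, Polynomial.eval₂_C, Polynomial.eval₂_pow, Polynomial.eval₂_X]
      simp only [map_add, map_mul, map_pow, hu 0, ← hr]
      ring
    exact jumpChart c hq hcm 1 0 (by decide) 𝔴 χ hloc h𝔴 _ hχ (TowerCut.mem_colon_of_map_eq _ hf hf') _ r
      rfl hI₀ hirr1

/-- **ENGINE `NormalConeJumpExit` — PROVED.**  On a regular scheme, a uniformly flat curve `cl{η}` of order
`n ≥ 2` has an exit package over it consisting of the curve blow-up ALONE: after it the controlled transform
has order `≤ 1` (or is `(1)`) at every point over the curve — at the closed points by the `u`-chart linear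
form `e₀ⁿ + σλ·σv + t r` in the regular parameters `(e₀, t, σv)`, at the points over `η` because the fibre of
the normal cone is cut by the irreducible `Xⁿ + μ̄ ∈ κ(η)[X]` — so the order-`n` locus over the curve is EMPTY
and the exit clause holds vacuously. [folklore] -/
theorem normalConeJumpExit_holds : NormalConeJumpExit := by
  intro Y hY I n hn η hU hLN
  obtain ⟨hcurve, hflat⟩ := hU
  haveI : IsLocallyNoetherian Y := hLN
  -- a closed point of the curve
  obtain ⟨y₀, hy₀, hy₀η⟩ : ∃ y₀ : Y, η ⤳ y₀ ∧ y₀ ≠ η := by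
    by_contra hcon
    push Not at hcon
    refine hcurve.1 ?_
    have hcl : closure ({η} : Set Y) = {η} := by
      refine Set.Subset.antisymm (fun y hy => ?_) subset_closure
      exact hcon y (specializes_iff_mem_closure.mpr hy)
    rw [← hcl]
    exact isClosed_closure
  have hy₀c : IsClosed ({y₀} : Set Y) := hcurve.2 y₀ hy₀ hy₀η
  -- the curve centre `C₀ = 𝓘(cl{η})`
  set C0 : Y.IdealSheafData :=
    Scheme.IdealSheafData.vanishingIdeal (⟨closure ({η} : Set Y), isClosed_closure⟩ : Closeds Y) with hC0def
  have hC0supp : ∀ y : Y, y ∈ (C0.support : Set Y) ↔ η ⤳ y := fun y => by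
    rw [hC0def, coe_support_vanishingIdeal, specializes_iff_mem_closure]
    rfl
  have hC0st : ∀ (y : Y) (h : η ⤳ y), stalkIdeal C0 y = curvePrime h := fun y h => by
    rw [hC0def, stalkIdeal_vanishingIdeal_closure h]
    rfl
  have hC0η : stalkIdeal C0 η = maximalIdeal _ := by
    rw [hC0def]; exact stalkIdeal_vanishingIdeal_closure_self η
  have hC0reg : Scheme.IsRegular C0.subscheme := isRegular_flatCurve_subscheme hY I hcurve hflat
  have hsuppT : (C0.support : Set Y) ⊆ {y | η ⤳ y} := fun y hy => (hC0supp y).mp hy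
  have hsuppM : (C0.support : Set Y) ⊆ (⟨I, [], n⟩ : MarkedIdeal Y).support := by
    intro y hy
    have h : η ⤳ y := (hC0supp y).mp hy
    rw [MarkedIdeal.mem_support_iff]
    change stalkIdeal I y ≤ maximalIdeal _ ^ n
    by_cases hyc : IsClosed ({y} : Set Y)
    · obtain ⟨h', hle, hPm⟩ := flat_stalkIdeal_le I (hflat y h hyc)
      exact hle.trans (Ideal.pow_right_mono hPm n)
    · have hyη : y = η := by
        by_contra hne
        exact hyc (hcurve.2 y h hne)
      subst hyη
      obtain ⟨h', hle, -⟩ := flat_stalkIdeal_le I (hflat y₀ hy₀ hy₀c)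
      rw [← stalkIdeal_map_stalkSpecializes I h']
      refine (Ideal.map_mono hle).trans ?_
      rw [Ideal.map_pow]
      exact Ideal.pow_right_mono Ideal.map_comap_le n
  -- the blow-up `Y₁ → Y` of the curve is regular; the invariant over the curve
  haveI := CentreSeq.isLocallyNoetherian_blowup C0
  have hY₁ : Scheme.IsRegular ↑(blowup C0) :=
    IsBlowup.isRegular_of_isRegular_subscheme hY hC0reg (blowup.isBlowup C0)
  have hinv : ∀ x' : ↑(blowup C0), η ⤳ blowup.π C0 x' →
      stalkIdeal (controlledTransform (blowup.π C0) C0 I n) x' = ⊤ ∨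
        ¬ stalkIdeal (controlledTransform (blowup.π C0) C0 I n) x' ≤ maximalIdeal _ ^ 2 := by
    intro x' hηx
    by_cases hcl : IsClosed ({blowup.π C0 x'} : Set Y)
    · exact flatInv_closed hY C0 I (by omega) hC0st x' (hflat _ hηx hcl)
    · have hπη : blowup.π C0 x' = η := by
        by_contra hne
        exact hcl (hcurve.2 _ hηx hne)
      exact flatInv_eta hY C0 I (by omega) hy₀η hC0η (hflat y₀ hy₀ hy₀c) x' hπη
  refine ⟨CentreSeq.cons C0 (CentreSeq.nil _), ⟨hsuppM, hC0reg, trivial⟩, ⟨hsuppT, trivial⟩, hY₁,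
    fun x hx hord => ?_⟩
  exfalso
  have hηx : η ⤳ blowup.π C0 x := hx
  have hord' : ((n : ℕ) : ℕ∞) ≤ idealOrder (controlledTransform (blowup.π C0) C0 I n) x := by
    have h1 := le_of_eq hord.symm
    simpa [CentreSeq.transformMarked_cons, CentreSeq.transformMarked_nil] using h1
  have hle : stalkIdeal (controlledTransform (blowup.π C0) C0 I n) x ≤ maximalIdeal _ ^ n :=
    (le_idealOrder_iff _ x n).mp hord'
  rcases hinv x hηx with htop | hnot
  · rw [htop, top_le_iff] at hle
    have h := Ideal.pow_le_self (I := maximalIdeal ((blowup C0 : Scheme.{0}).presheaf.stalk x)) (n := n)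
      (by omega)
    rw [hle, top_le_iff] at h
    exact (maximalIdeal.isMaximal _).ne_top h
  · exact hnot (hle.trans (Ideal.pow_le_pow_right hn))

end SchemeLevel

/-! ## §9  DISCHARGE COROLLARY: the landed 17-engine corollary `TowerCut.cuspGenericRung_of_engines` with the binder
`hN : NormalConeJumpExit` removed BY NAME (16 engine binders left) -/

section Corollaries

open Summit.ResolutionOfSingularities.ResolutionOfSingularities.Theorems
open Summit.ResolutionOfSingularities.ResolutionOfSingularities.Theorems.WeakOrderReduction
open Summit.ResolutionOfSingularities.ResolutionOfSingularities.Theorems.DeltaFaceCutClasses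
open Summit.ResolutionOfSingularities.ResolutionOfSingularities.Theorems.RelativeDeltaCut
open Summit.ResolutionOfSingularities.ResolutionOfSingularities.Theorems.FaceFormCutClasses
open Summit.ResolutionOfSingularities.ResolutionOfSingularities.Theorems.CurveLeafExit
open Summit.ResolutionOfSingularities.ResolutionOfSingularities.Theorems.PinchCut
open Summit.ResolutionOfSingularities.ResolutionOfSingularities.Theorems.JetCut
open Summit.ResolutionOfSingularities.ResolutionOfSingularities.Theorems.PurityCut
open Summit.ResolutionOfSingularities.ResolutionOfSingularities.Theorems.SplitCut
open Summit.ResolutionOfSingularities.ResolutionOfSingularities.Theorems.CylinderCut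
open Summit.ResolutionOfSingularities.ResolutionOfSingularities.Theorems.CrossCut
open Summit.ResolutionOfSingularities.ResolutionOfSingularities.Theorems.DeepCrossCut
open Summit.ResolutionOfSingularities.ResolutionOfSingularities.Theorems.OddCrossCut
open Summit.ResolutionOfSingularities.ResolutionOfSingularities.Theorems.CuspCut
open Summit.ResolutionOfSingularities.ResolutionOfSingularities.Theses

/-- **`CuspX.CuspGenericRung` FROM SIXTEEN ENGINES** — the landed `TowerCut.cuspGenericRung_of_engines`
(17 engine binders) with its binder `hN : NormalConeJumpExit` DISCHARGED by `normalConeJumpExit_holds`.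
[folklore] -/
theorem cuspGenericRung_of_engines (hV : VeryNearCutClasses.VeryNearExit) (hD : DeltaPackageExit)
    (hU : UniformCurvePackageExit) (hR : RelCurvePackageExit) (hM : MonomialPinchExit) (hC : FlatConeExit)
    (hGE : GrandExit) (hSE : SplitConeExit) (hJE : JetCylinderExit)
    (hX : MaxContactCut.MaxOrderThreefoldResolution) (hXE : CrossExit) (hDXE : DeepCrossExit) (hNE : NodeExit)
    (hOXE : OddCrossExit) (hCuE : CuspExit) (hTaE : TameTwoExit) : CuspX.CuspGenericRung :=
  TowerCut.cuspGenericRung_of_engines hV hD hU hR normalConeJumpExit_holds hM hC hGE hSE hJE hX hXE hDXE hNE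
    hOXE hCuE hTaE

/-- **`MaxContactCut.RungOne` BY NAME from sixteen engines and the located residual `CuspX.CuspSpecialRung`**
(`CuspX.closes`, cited, not re-landed). [folklore] -/
theorem closes_of_engines (hV : VeryNearCutClasses.VeryNearExit) (hD : DeltaPackageExit)
    (hU : UniformCurvePackageExit) (hR : RelCurvePackageExit) (hM : MonomialPinchExit) (hC : FlatConeExit)
    (hGE : GrandExit) (hSE : SplitConeExit) (hJE : JetCylinderExit)
    (hX : MaxContactCut.MaxOrderThreefoldResolution) (hXE : CrossExit) (hDXE : DeepCrossExit) (hNE : NodeExit)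
    (hOXE : OddCrossExit) (hCuE : CuspExit) (hTaE : TameTwoExit) (hS : CuspX.CuspSpecialRung) :
    MaxContactCut.RungOne :=
  CuspX.closes (cuspGenericRung_of_engines hV hD hU hR hM hC hGE hSE hJE hX hXE hDXE hNE hOXE hCuE hTaE) hS

end Corollaries

end Summit.ResolutionOfSingularities.ResolutionOfSingularities.Theorems.ConeJump
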